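import Summits.KontsevichZagierPeriods.KontsevichZagierPeriods.Theses.IsogenyCertificates
import Summits.KontsevichZagierPeriods.KontsevichZagierPeriods.Theorems.EffectiveXMapChains.Negative.CountedTransfer
import Summits.KontsevichZagierPeriods.KontsevichZagierPeriods.Theorems.EffectiveXMapChains.Negative.Mechanism
import Summits.KontsevichZagierPeriods.KontsevichZagierPeriods.Theorems.EffectiveXMapChains.Negative.PeriodRep
import Summits.KontsevichZagierPeriods.KontsevichZagierPeriods.Theorems.EffectiveXMapChains.Negative.LimitValue
import Literature.NumberTheory.Transcendental.KZRelationsLE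
import Literature.NumberTheory.Transcendental.KZProductIdeal
import Literature.NumberTheory.Transcendental.SemialgebraicMapsProofs
import Literature.ModelTheory.ExponentialFields.SemialgebraicComponents
import Summits.KontsevichZagierPeriods.KontsevichZagierPeriods.Theorems.IsogenyCertificatesEffectiveXMapChainsStubCoprimeReduction
import Summits.KontsevichZagierPeriods.KontsevichZagierPeriods.Theorems.IsogenyCertificatesEffectiveXMapChainsStubDissection
import Summits.KontsevichZagierPeriods.KontsevichZagierPeriods.Theorems.IsogenyCertificatesEffectiveXMapChainsStubPieceCoV
import Summits.KontsevichZagierPeriods.KontsevichZagierPeriods.Theorems.IsogenyCertificatesEffectiveXMapChainsStubDup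
import Summits.KontsevichZagierPeriods.KontsevichZagierPeriods.Theorems.IsogenyCertificatesEffectiveXMapChainsStubClosing
import Summits.KontsevichZagierPeriods.KontsevichZagierPeriods.Theorems.IsogenyCertificatesEffectiveXMapChainsStubPieceOntoComponent
import Summits.KontsevichZagierPeriods.KontsevichZagierPeriods.Theorems.IsogenyCertificatesXMapPeriodTransferCellsBasic

/-!
# `EffectiveXMapChains` (stmt-KontsevichZagierPeriods-10664, route IsogenyCertificates) — line
`full-component-sheets` (reshaped: `[2]`-normaliser instead of the Möbius step): the composition

The crux: a Masser–Wüstholz-type bound on the degree of an x-rational isogeny datum `(f, g, c)`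
(`W = f'g − fg' ≠ 0`, `c²·g·(f³ + A'fg² + B'g³) = (X³+AX+B)·W²`) implies a poly-log bound on the
LENGTH of a chain of Kontsevich–Zagier moves joining two equal-valued real-period representations
`r = [{P>0}, a/√P]`, `r' = [{P'>0}, b/√P']`. `EffectiveXMapChains_of` proves it BY NAME:

* the bridge `effectiveXMapChains_of_countedTransfer` (Theorems/EffectiveXMapChains/Negative/
  CountedTransfer) reduces the crux to COUNTED TRANSFER — for every datum a chain of length
  `≤ 162·N + 274 ≤ 436·max(1, N)`, `N = max (deg f) (deg g)` (`countedTransfer`);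
* `stub_coprimeReduction` (…StubCoprimeReduction): the datum may be taken coprime;
* `stub_dissection` (…StubDissection): a representation on an admissible domain `D ⊆ {P>0}` (an
  open union of components) is, in `T.card + 4` moves, the sum of its restrictions to the pieces
  (connected components of the sheet set `S = {P>0, g ≠ 0, W ≠ 0}` inside `D`), `T.card ≤ 3N + 4`;
* `stub_pieceOntoComponent` (…StubPieceOntoComponent, the full-sheet lemma): on each piece
  `R = f/g` is injective and maps the piece ONTO a whole connected component of `{P'>0}`;
* `stub_pieceCoV` (…StubPieceCoV): one rule-2 move per piece;
  together: `transfer` — `[D, a/√P] ≡ Σ_t [comp'(R t), (a/|c|)/√P']` in `2·T.card + 4` moves;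
* `stub_dup` (…StubDup): the duplication datum `(X⁴ − 2A'X² − 8B'X + A'², 4(X³+A'X+B'), 2)` of the
  target curve is a coprime datum of degree `4` all of whose sheets land in the unbounded component
  `unb' = {x | ∀ w ≥ x, P'(w) > 0}`; a second `transfer` along it normalises every component
  representation — and `r'` itself — to a multiple of `[unb', s/√P']` (`dupTransfer`; this replaces
  the Möbius 2-torsion step of the card);
* `stub_closing` (…StubClosing): `m • [unb', s/√P'] − n • [unb', t/√P']` with equal values is a chain
  of length `m + n + 2`; the values agree by soundness of the chains built and `r.value = r'.value`.

No definitions are introduced; the vocabulary (`{P>0}`, the sheet set, `unb`, lifts to `ℝ¹`) is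
spelled out, and the basic API is reused from `IsogenyCertificatesXMapPeriodTransferCellsBasic`.

References: Kontsevich–Zagier, *Periods* (2001) §1.2; Silverman, AEC (2009) III.2.3(d), III.4;
Gaudron–Rémond (2014) Thm 1.4 (shape of the antecedent); Basu–Pollack–Roy (2006) Thm 5.22.
-/

noncomputable section

open Polynomial Set MeasureTheory
open Literature.NumberTheory.Transcendental Literature.ModelTheory.ExponentialFields
open Summit.KontsevichZagierPeriods.IsogenyCertificates.EffectiveXMapChainsNegative
open Summit.KontsevichZagierPeriods.IsogenyCertificates.XMapPeriodTransferCells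
  (cubic_pos_of_large_le isOpen_setOf_cubic_pos isSemialgebraic_hat_connectedComponentIn
    isSemialgebraic_hat_cubic_pos)

namespace Summit.KontsevichZagierPeriods.IsogenyCertificates.EffectiveXMapChainsLine

/-! ## Vocabulary used by the composition (no new definitions: everything is spelled out) -/

section Assembly

variable {A B A' B' : ℤ}

/-- The sheet set of a datum sits inside `{P > 0}`. [folklore] -/
theorem sheetSet_subset (A B : ℤ) (f g : ℚ[X]) :
    {x : ℝ | 0 < x ^ 3 + (A : ℝ) * x + (B : ℝ) ∧ aeval x g ≠ 0 ∧
        aeval x (derivative f * g - f * derivative g) ≠ 0} ⊆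
      {x : ℝ | 0 < x ^ 3 + (A : ℝ) * x + (B : ℝ)} :=
  fun _ hx => hx.1

/-! ### The unbounded component `unb = {x | ∀ t ≥ x, P(t) > 0}` -/

/-- `unb ⊆ {P > 0}`. [folklore] -/
theorem unb_subset (A B : ℤ) :
    {x : ℝ | ∀ w : ℝ, x ≤ w → 0 < w ^ 3 + (A : ℝ) * w + (B : ℝ)} ⊆
      {x : ℝ | 0 < x ^ 3 + (A : ℝ) * x + (B : ℝ)} :=
  fun x hx => hx x le_rfl

/-- The point `1 + |A| + |B|` lies in `unb` (Cauchy bound). [folklore] -/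
theorem M0_mem_unb (A B : ℤ) :
    (1 + |(A : ℝ)| + |(B : ℝ)|) ∈ {x : ℝ | ∀ w : ℝ, x ≤ w → 0 < w ^ 3 + (A : ℝ) * w + (B : ℝ)} :=
  fun _ hw => cubic_pos_of_large_le A B hw

/-- `unb` IS the connected component of `{P > 0}` through any of its points. [folklore] -/
theorem connectedComponentIn_eq_unb (A B : ℤ) {y : ℝ}
    (hy : y ∈ {x : ℝ | ∀ w : ℝ, x ≤ w → 0 < w ^ 3 + (A : ℝ) * w + (B : ℝ)}) :
    connectedComponentIn {x : ℝ | 0 < x ^ 3 + (A : ℝ) * x + (B : ℝ)} y =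
      {x : ℝ | ∀ w : ℝ, x ≤ w → 0 < w ^ 3 + (A : ℝ) * w + (B : ℝ)} := by
  set U : Set ℝ := {x : ℝ | ∀ w : ℝ, x ≤ w → 0 < w ^ 3 + (A : ℝ) * w + (B : ℝ)} with hU
  set F : Set ℝ := {x : ℝ | 0 < x ^ 3 + (A : ℝ) * x + (B : ℝ)} with hF
  have hUF : U ⊆ F := unb_subset A B
  have hyF : y ∈ F := hUF hy
  -- `U` is order-connected, hence preconnected
  have hUoc : OrdConnected U := ⟨fun a ha b _ z hz w hw => ha w (hz.1.trans hw)⟩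
  have hUconn : IsPreconnected U := hUoc.isPreconnected
  apply Subset.antisymm
  · intro z hz
    have hK : IsPreconnected (connectedComponentIn F y) := isPreconnected_connectedComponentIn
    have hKF : connectedComponentIn F y ⊆ F := connectedComponentIn_subset F y
    have hyK : y ∈ connectedComponentIn F y := mem_connectedComponentIn hyF
    intro w hw
    by_cases hwy : y ≤ w
    · exact hy w hwy
    · -- `z ≤ w < y`: `w` lies between two points of the component
      have hwK : w ∈ connectedComponentIn F y :=
        hK.ordConnected.out hz hyK ⟨hw, le_of_lt (not_le.mp hwy)⟩
      exact hKF hwK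
  · exact hUconn.subset_connectedComponentIn hy hUF

/-- The lift of `unb` to `ℝ¹` is `ℚ`-semialgebraic (it is a connected component of `{P > 0}`).
[cite: BasuPollackRoy2006, Thm. 5.22] -/
theorem isSemialgebraic_lift_unb (A B : ℤ) :
    IsSemialgebraic ℚ {x : Fin 1 → ℝ | x 0 ∈
      {x : ℝ | ∀ w : ℝ, x ≤ w → 0 < w ^ 3 + (A : ℝ) * w + (B : ℝ)}} := by
  rw [← connectedComponentIn_eq_unb A B (M0_mem_unb A B)]
  exact isSemialgebraic_hat_connectedComponentIn (isSemialgebraic_hat_cubic_pos A B) _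

/-! ### Chain bookkeeping -/

/-- A rule-2 instance between two representations of dimension `1` is a chain of length `1` in
dimension `1`. [cite: KontsevichZagier2001, §1.2] -/
theorem chainLE_of_cov {ρ q : KZ.IntegralRep 1} (h : KZ.of ρ - KZ.of q ∈ KZ.changeOfVariablesRel) :
    KZ.ChainLE 1 1 (KZ.of ρ - KZ.of q) :=
  KZ.ChainLE.of_mem_movesLE ⟨Or.inl (Or.inr h),
    sub_mem (KZ.of_mem_formalRepLE ρ le_rfl) (KZ.of_mem_formalRepLE q le_rfl)⟩

/-- Sums of chains over a finset: lengths add. [cite: KontsevichZagier2001, §1.2] -/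
theorem chainLE_finset_sum {ι : Type*} (T : Finset ι) (x : ι → KZ.FormalRep) (d : ℕ) (ℓ : ι → ℕ)
    (h : ∀ i ∈ T, KZ.ChainLE d (ℓ i) (x i)) :
    KZ.ChainLE d (∑ i ∈ T, ℓ i) (∑ i ∈ T, x i) := by
  classical
  induction T using Finset.induction_on with
  | empty => simpa using KZ.ChainLE.zero d 0
  | insert a T ha ih =>
    rw [Finset.sum_insert ha, Finset.sum_insert ha]
    exact (h a (Finset.mem_insert_self a T)).add
      (ih fun i hi => h i (Finset.mem_insert_of_mem hi))

/-- A chain proves a relation, hence preserves values (soundness of the calculus).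
[cite: KontsevichZagier2001, §1.2] -/
theorem eval_eq_of_chainLE {d ℓ : ℕ} {x y : KZ.FormalRep} (h : KZ.ChainLE d ℓ (x - y)) :
    KZ.eval x = KZ.eval y := by
  have hmem : x - y ∈ KZ.relations := h.mem_relations
  have hker := KZ.relations_le_ker_eval_holds hmem
  rw [AddMonoidHom.mem_ker, map_sub, sub_eq_zero] at hker
  exact hker

/-! ### The full-sheet transfer of a representation on an admissible domain -/

/-- **Transfer along a coprime datum.** Let `D ⊆ {P > 0}` be admissible (an open union of connected
components with `ℚ`-semialgebraic lift) and `r = [D, a/√P]` (integrand prescribed on the domain).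
Dissect `D` into the pieces of the sheet set (`stub_dissection`), and push each piece forward along
`R = f/g` onto a whole component of `{P' > 0}` (`stub_pieceOntoComponent`, `stub_pieceCoV`):
`[r] ≡ Σ_{t ∈ T} [comp'(R t), (a/|c|)/√P']` by a chain of `2·T.card + 4` moves in dimension `1`,
with `T.card ≤ 3N + 4`. [cite: KontsevichZagier2001, §1.2 rules (1), (2)] -/
theorem transfer (hΔ' : 4 * A' ^ 3 + 27 * B' ^ 2 ≠ 0) {f g : ℚ[X]} {c : ℚ}
    (hcop : IsCoprime f g) (hW : derivative f * g - f * derivative g ≠ 0)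
    (hI : C (c ^ 2) * g * (f ^ 3 + C (A' : ℚ) * f * g ^ 2 + C (B' : ℚ) * g ^ 3) =
      (X ^ 3 + C (A : ℚ) * X + C (B : ℚ)) * (derivative f * g - f * derivative g) ^ 2)
    (a : ℚ) {D : Set ℝ} (hD : D ⊆ {x : ℝ | 0 < x ^ 3 + (A : ℝ) * x + (B : ℝ)}) (hDopen : IsOpen D)
    (hsat : ∀ x ∈ D, connectedComponentIn {x : ℝ | 0 < x ^ 3 + (A : ℝ) * x + (B : ℝ)} x ⊆ D)
    (hDsa : IsSemialgebraic ℚ {x : Fin 1 → ℝ | x 0 ∈ D})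
    (r : KZ.IntegralRep 1) (hr : r.domain = {x : Fin 1 → ℝ | x 0 ∈ D})
    (hri : EqOn r.integrand (fun x => (a : ℝ) / Real.sqrt (x 0 ^ 3 + (A : ℝ) * x 0 + (B : ℝ)))
      r.domain) :
    ∃ (T : Finset ℝ) (q : ℝ → KZ.IntegralRep 1),
      (∀ t ∈ T, t ∈ {x : ℝ | 0 < x ^ 3 + (A : ℝ) * x + (B : ℝ) ∧ aeval x g ≠ 0 ∧
        aeval x (derivative f * g - f * derivative g) ≠ 0}) ∧
      (∀ t ∈ T, (q t).domain = {y : Fin 1 → ℝ | y 0 ∈ connectedComponentIn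
          {y : ℝ | 0 < y ^ 3 + (A' : ℝ) * y + (B' : ℝ)} (aeval t f / aeval t g)} ∧
        (q t).integrand = fun y => ((a / |c| : ℚ) : ℝ) /
          Real.sqrt (y 0 ^ 3 + (A' : ℝ) * y 0 + (B' : ℝ))) ∧
      T.card ≤ 3 * max f.natDegree g.natDegree + 4 ∧
      KZ.ChainLE 1 (2 * T.card + 4) (KZ.of r - ∑ t ∈ T, KZ.of (q t)) := by
  -- the sheet set and the target components
  set S : Set ℝ := {x : ℝ | 0 < x ^ 3 + (A : ℝ) * x + (B : ℝ) ∧ aeval x g ≠ 0 ∧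
    aeval x (derivative f * g - f * derivative g) ≠ 0} with hS
  set F' : Set ℝ := {y : ℝ | 0 < y ^ 3 + (A' : ℝ) * y + (B' : ℝ)} with hF'
  set q : ℝ → KZ.IntegralRep 1 := fun t => (periodRep A' B' (a / |c|) hΔ').restrict
    {y : Fin 1 → ℝ | y 0 ∈ connectedComponentIn F' (aeval t f / aeval t g)}
    (isSemialgebraic_hat_connectedComponentIn (isSemialgebraic_hat_cubic_pos A' B') _)
    (fun y hy => show 0 < y 0 ^ 3 + (A' : ℝ) * y 0 + (B' : ℝ) from
      connectedComponentIn_subset F' (aeval t f / aeval t g) hy) with hq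
  obtain ⟨T, ρ, hT, hρ, hcard, hchain⟩ := stub_dissection A B f g hW D hD hDopen hsat hDsa r hr
  refine ⟨T, q, fun t ht => (hT t ht).2, fun t _ => ⟨rfl, rfl⟩, hcard, ?_⟩
  have hcov : ∀ t ∈ T, KZ.ChainLE 1 1 (KZ.of (ρ t) - KZ.of (q t)) := by
    intro t ht
    obtain ⟨htD, htS⟩ := hT t ht
    obtain ⟨hinj, himg⟩ := stub_pieceOntoComponent A B A' B' f g c hcop hW hI t htS
    refine chainLE_of_cov (stub_pieceCoV A B A' B' f g c hW hI t hinj a (ρ t) (q t) (hρ t ht).1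
      ?_ ?_ ?_)
    · -- the integrand of the restriction `ρ t` on its domain
      intro x hx
      rw [(hρ t ht).2]
      apply hri
      rw [hr]
      have hx' : x 0 ∈ connectedComponentIn S t := by
        rw [(hρ t ht).1] at hx; exact hx
      exact hsat t htD ((connectedComponentIn_mono t (sheetSet_subset A B f g)) hx')
    · -- the domain of the target is the lift of the image
      show {y : Fin 1 → ℝ | y 0 ∈ connectedComponentIn F' (aeval t f / aeval t g)} = _
      rw [← himg]
    · intro y _; rfl
  have hsum := chainLE_finset_sum T (fun t => KZ.of (ρ t) - KZ.of (q t)) 1 (fun _ => 1) hcov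
  have htot := hchain.add hsum
  rw [Finset.sum_sub_distrib, sub_add_sub_cancel] at htot
  refine htot.mono le_rfl ?_
  simp only [Finset.sum_const, smul_eq_mul, mul_one]
  omega

/-- **The `[2]`-normalisation.** Along the duplication datum of `(A', B')` every piece lands on the
unbounded component `unb'`, so a representation `[D', s/√P']` on an admissible `D' ⊆ {P' > 0}` is,
in at most `36` moves, `n • [unb', (s/|2|)/√P']` with `n ≤ 16`. [cite: SilvermanAEC2009, III.2.3(d)] -/
theorem dupTransfer (hΔ' : 4 * A' ^ 3 + 27 * B' ^ 2 ≠ 0) (s : ℚ)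
    {D : Set ℝ} (hD : D ⊆ {x : ℝ | 0 < x ^ 3 + (A' : ℝ) * x + (B' : ℝ)}) (hDopen : IsOpen D)
    (hsat : ∀ x ∈ D, connectedComponentIn {x : ℝ | 0 < x ^ 3 + (A' : ℝ) * x + (B' : ℝ)} x ⊆ D)
    (hDsa : IsSemialgebraic ℚ {x : Fin 1 → ℝ | x 0 ∈ D})
    (r : KZ.IntegralRep 1) (hr : r.domain = {x : Fin 1 → ℝ | x 0 ∈ D})
    (hri : EqOn r.integrand (fun x => (s : ℝ) / Real.sqrt (x 0 ^ 3 + (A' : ℝ) * x 0 + (B' : ℝ)))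
      r.domain) :
    ∃ n : ℕ, n ≤ 16 ∧ KZ.ChainLE 1 36 (KZ.of r - n • KZ.of ((periodRep A' B' (s / |(2 : ℚ)|) hΔ').restrict
      {y : Fin 1 → ℝ | y 0 ∈ {x : ℝ | ∀ w : ℝ, x ≤ w → 0 < w ^ 3 + (A' : ℝ) * w + (B' : ℝ)}}
      (isSemialgebraic_lift_unb A' B') (fun _ hy => unb_subset A' B' hy))) := by
  obtain ⟨hcop, hW, hI, hdeg, hunb⟩ := stub_dup A' B' hΔ'
  obtain ⟨T, q, hT, hq, hcard, hchain⟩ :=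
    transfer hΔ' hcop hW hI s hD hDopen hsat hDsa r hr hri
  refine ⟨T.card, by omega, ?_⟩
  have hqU : ∀ t ∈ T, q t = (periodRep A' B' (s / |(2 : ℚ)|) hΔ').restrict
      {y : Fin 1 → ℝ | y 0 ∈ {x : ℝ | ∀ w : ℝ, x ≤ w → 0 < w ^ 3 + (A' : ℝ) * w + (B' : ℝ)}}
      (isSemialgebraic_lift_unb A' B') (fun _ hy => unb_subset A' B' hy) := by
    intro t ht
    refine KZ.IntegralRep.ext' ?_ ?_
    · rw [(hq t ht).1, KZ.IntegralRep.domain_restrict, connectedComponentIn_eq_unb A' B' (hunb t (hT t ht))]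
    · rw [(hq t ht).2]; rfl
  rw [Finset.sum_congr rfl fun t ht => congrArg KZ.of (hqU t ht), Finset.sum_const] at hchain
  exact hchain.mono le_rfl (by omega)

/-! ### Counted transfer and the crux -/

/-- **Counted transfer** (crux #3 with a move count, for every datum): two equal-valued real-period
representations joined by an x-rational isogeny datum of degree `N` are joined by a chain of at most
`162·N + 274` moves in dimension `1`. Route: coprime reduction; transfer of `r` along the datum onto
component representations of `{P' > 0}`; `[2]`-normalisation of each of them, and of `r'`, to
multiples of `[unb', ·/√P']`; closing by value equality. [cite: KontsevichZagier2001, §1.2] -/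
theorem countedTransfer (A B A' B' : ℤ) (hΔ : 4 * A ^ 3 + 27 * B ^ 2 ≠ 0)
    (hΔ' : 4 * A' ^ 3 + 27 * B' ^ 2 ≠ 0) (f g : ℚ[X]) (c : ℚ)
    (hW : derivative f * g - f * derivative g ≠ 0)
    (hI : C (c ^ 2) * g * (f ^ 3 + C (A' : ℚ) * f * g ^ 2 + C (B' : ℚ) * g ^ 3) =
      (X ^ 3 + C (A : ℚ) * X + C (B : ℚ)) * (derivative f * g - f * derivative g) ^ 2)
    (a b : ℚ) (ha : 0 < a) (hb : 0 < b) (r r' : KZ.IntegralRep 1)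
    (h1 : r.domain = {x | 0 < x 0 ^ 3 + (A : ℝ) * x 0 + (B : ℝ)})
    (h2 : EqOn r.integrand (fun x => (a : ℝ) / Real.sqrt (x 0 ^ 3 + (A : ℝ) * x 0 + (B : ℝ)))
      r.domain)
    (h3 : r'.domain = {x | 0 < x 0 ^ 3 + (A' : ℝ) * x 0 + (B' : ℝ)})
    (h4 : EqOn r'.integrand (fun x => (b : ℝ) / Real.sqrt (x 0 ^ 3 + (A' : ℝ) * x 0 + (B' : ℝ)))
      r'.domain)
    (h5 : r.value = r'.value) :
    KZ.ChainLE 1 (162 * max f.natDegree g.natDegree + 274) (KZ.of r - KZ.of r') := by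
  have _hΔ := hΔ
  -- coprime reduction
  obtain ⟨f₁, g₁, hcop, hW₁, hI₁, hdeg⟩ := stub_coprimeReduction A B A' B' f g c hW hI
  have hc : c ≠ 0 := c_ne_zero_of_datum hW hI
  set F : Set ℝ := {x : ℝ | 0 < x ^ 3 + (A : ℝ) * x + (B : ℝ)} with hF
  set F' : Set ℝ := {y : ℝ | 0 < y ^ 3 + (A' : ℝ) * y + (B' : ℝ)} with hF'
  set U' : Set ℝ := {x : ℝ | ∀ w : ℝ, x ≤ w → 0 < w ^ 3 + (A' : ℝ) * w + (B' : ℝ)} with hU'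
  -- the unbounded-component representations `[unb', q/√P']`
  set uR : ℚ → KZ.IntegralRep 1 := fun q => (periodRep A' B' q hΔ').restrict
    {y : Fin 1 → ℝ | y 0 ∈ U'} (isSemialgebraic_lift_unb A' B') (fun _ hy => unb_subset A' B' hy)
    with huR
  -- r-side, level 1: transfer along the coprime datum
  obtain ⟨T, q, hT, hq, hcard, hchain⟩ := transfer hΔ' hcop hW₁ hI₁ a (D := F) subset_rfl
    (isOpen_setOf_cubic_pos A B) (fun x _ => connectedComponentIn_subset _ _)
    (isSemialgebraic_hat_cubic_pos A B) r (h1.trans (Set.ext fun _ => Iff.rfl)) h2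
  -- r-side, level 2: `[2]`-normalise every component representation
  have hlev2 : ∀ t ∈ T, ∃ n : ℕ, n ≤ 16 ∧
      KZ.ChainLE 1 36 (KZ.of (q t) - n • KZ.of (uR (a / |c| / |(2 : ℚ)|))) := by
    intro t ht
    refine dupTransfer hΔ' (a / |c|) (D := connectedComponentIn F' (aeval t f₁ / aeval t g₁))
      (connectedComponentIn_subset _ _) ((isOpen_setOf_cubic_pos A' B').connectedComponentIn)
      (fun x hx => (connectedComponentIn_eq hx).symm ▸ subset_rfl)
      (isSemialgebraic_hat_connectedComponentIn (isSemialgebraic_hat_cubic_pos A' B') _)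
      (q t) (hq t ht).1 (fun y _ => ?_)
    rw [(hq t ht).2]
  choose! nf hn16 hnchain using hlev2
  have hsum := chainLE_finset_sum T (fun t => KZ.of (q t) - nf t • KZ.of (uR (a / |c| / |(2 : ℚ)|)))
    1 (fun _ => 36) hnchain
  rw [Finset.sum_sub_distrib, ← Finset.sum_smul] at hsum
  set m : ℕ := ∑ t ∈ T, nf t with hm
  have hm_le : m ≤ 16 * T.card := by
    calc m = ∑ t ∈ T, nf t := rfl
      _ ≤ ∑ _t ∈ T, 16 := Finset.sum_le_sum hn16
      _ = 16 * T.card := by simp [mul_comm]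
  have hr_chain : KZ.ChainLE 1 ((2 * T.card + 4) + ∑ _t ∈ T, 36)
      (KZ.of r - m • KZ.of (uR (a / |c| / |(2 : ℚ)|))) := by
    have h := hchain.add hsum
    rwa [sub_add_sub_cancel] at h
  -- r'-side: `[2]`-normalise `r'` itself
  obtain ⟨n', hn'16, hr'_chain⟩ := dupTransfer hΔ' b (D := F') subset_rfl (isOpen_setOf_cubic_pos A' B')
    (fun x _ => connectedComponentIn_subset _ _) (isSemialgebraic_hat_cubic_pos A' B') r'
    (h3.trans (Set.ext fun _ => Iff.rfl)) h4
  -- closing: values agree by soundness of the two chains and `h5`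
  have hval : KZ.eval (m • KZ.of (uR (a / |c| / |(2 : ℚ)|))) = KZ.eval (n' • KZ.of (uR (b / |(2 : ℚ)|))) := by
    rw [← eval_eq_of_chainLE hr_chain, ← eval_eq_of_chainLE hr'_chain, KZ.eval_of, KZ.eval_of]
    exact h5
  have hs_pos : 0 < a / |c| / |(2 : ℚ)| := div_pos (div_pos ha (abs_pos.mpr hc)) (by norm_num)
  have ht_pos : 0 < b / |(2 : ℚ)| := div_pos hb (by norm_num)
  have hclose := stub_closing A' B' hΔ' _ _ hs_pos ht_pos (uR (a / |c| / |(2 : ℚ)|))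
    (uR (b / |(2 : ℚ)|)) rfl rfl rfl rfl m n' hval
  -- combine the three chains
  have htot := hr_chain.add (hclose.sub hr'_chain)
  have e : KZ.of r - m • KZ.of (uR (a / |c| / |(2 : ℚ)|)) +
      (m • KZ.of (uR (a / |c| / |(2 : ℚ)|)) - n' • KZ.of (uR (b / |(2 : ℚ)|)) -
        (KZ.of r' - n' • KZ.of (uR (b / |(2 : ℚ)|)))) = KZ.of r - KZ.of r' := by abel
  rw [e] at htot
  refine htot.mono le_rfl ?_
  simp only [Finset.sum_const, smul_eq_mul]
  have hT1 : T.card ≤ 3 * max f₁.natDegree g₁.natDegree + 4 := hcard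
  have hT2 : max f₁.natDegree g₁.natDegree ≤ max f.natDegree g.natDegree := hdeg
  omega

/-- **The crux `EffectiveXMapChains`** (stmt-KontsevichZagierPeriods-10664), by the disprover's bridge
`effectiveXMapChains_of_countedTransfer` (the Masser–Wüstholz antecedent is bookkeeping over the
counted transfer, `L N = 162 N + 274 ≤ 436 · max 1 N`, `d = 1`). [cite: GaudronRemondPeriodes2014, Thm 1.4] -/
theorem EffectiveXMapChains_of :
    Summit.KontsevichZagierPeriods.KontsevichZagierPeriods.Theses.IsogenyCertificates.EffectiveXMapChains := by
  refine effectiveXMapChains_of_countedTransfer (L := fun N => 162 * (N : ℝ) + 274) (C₁ := 436)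
    (d := 1) zero_le_one ?_ ?_
  · intro N
    rw [Real.rpow_one]
    have h1 : (N : ℝ) ≤ max 1 (N : ℝ) := le_max_right _ _
    have h2 : (1 : ℝ) ≤ max 1 (N : ℝ) := le_max_left _ _
    linarith
  · intro A B A' B' hΔ hΔ' f g c hW hI a b ha hb r r' h1 h2 h3 h4 h5
    obtain ⟨l, hl, hmem, hsum⟩ :=
      countedTransfer A B A' B' hΔ hΔ' f g c hW hI a b ha hb r r' h1 h2 h3 h4 h5
    refine ⟨l, ?_, fun x hx => (hmem x hx).imp (fun h => h.1) (fun h => h.1), hsum⟩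
    exact_mod_cast hl

end Assembly

end Summit.KontsevichZagierPeriods.IsogenyCertificates.EffectiveXMapChainsLine
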